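import Literature.Probability.LatticeModels.TemperleyLiebConnectivityBasis
import HarnessLib

/-!
# The braid relations from the Temperley–Lieb relations at loop weight one (Kauffman's generators at the percolation point)

Topic `Literature/Probability/LatticeModels`; a rider on `TemperleyLiebLinkPatterns.lean` (`IsTemperleyLiebFamily δ e`: Pearce–Rittenberg–de Gier–Nienhuis's
relations `eⱼ² = δ eⱼ`, `eⱼ e_{j±1} eⱼ = eⱼ`, far commutation) and `TemperleyLiebConnectivityBasis.lean` (`tlConn m K`: the generators on Ikhlef–Ponsaing's
connectivity (cluster) basis `NCState (m+1) →₀ K`, ★ `isTemperleyLiebFamily_tlConn`: a Temperley–Lieb family with `δ = 1`).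

Kauffman (*Knots and Physics*, Part I §7) represents the braid generators in the Temperley–Lieb algebra by `σᵢ = A + A⁻¹Uᵢ`, the braid relations
following from the Temperley–Lieb relations with loop value `d = −A² − A⁻²`. AT LOOP VALUE ONE the computation collapses to a one-line criterion, which this
file records and instantiates:

* ★★ `braid_of_tl_one` — in any algebra, if `e₁² = e₁`, `e₂² = e₂`, `e₁e₂e₁ = e₁`, `e₂e₁e₂ = e₂` and the scalars satisfy **`a² + ab + b² = 0`** (i.e. `a/b` is a
  primitive cube root of unity — Kauffman's `(A⁻¹, A)` up to a common factor at `A = e^{±iπ/3}`), then `g₁ = a·1 + b·e₁`, `g₂ = a·1 + b·e₂` satisfy the BRAID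
  RELATION `g₁g₂g₁ = g₂g₁g₂`; `comm_of_tl_comm` (far generators commute);
* ★★ `IsTemperleyLiebFamily.braid` / `.braid_comm` — for every Temperley–Lieb family with `δ = 1`, the Kauffman generators `a·1 + b·eⱼ` (`a² + ab + b² = 0`)
  satisfy the braid relations of `B_{n+1}`;
* (ed. 2, general loop weight) ★★ `braid_of_tl` — the same at ANY loop weight `δ` under Kauffman's criterion **`a² + δab + b² = 0`** (`δ = −A² − A⁻²` for
  `(a, b) = (A, A⁻¹)`); ★★ `kauffman_mul_eq_one` — UNITARITY `(a + be)(a' + b'e) = 1` when `aa' = 1`, `ab' + ba' + δbb' = 0` (`σᵢ⁻¹ = A⁻¹ + AUᵢ`),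
  `kauffman_mul_eq_one_of_one` (loop weight one: `(u + ve)(v + ue) = 1` for `uv = 1`, `u² + uv + v² = 0`); family versions
  `IsTemperleyLiebFamily.braid_of_loopWeight` / `.braid_comm_of_loopWeight`, `IsTemperleyLiebFamily.kauffmanGen_mul_kauffmanGen`;
* ★★★ `tlConn_braid` / `tlConn_braid_comm` — **ON IKHLEF–PONSAING'S CONNECTIVITY (CLUSTER) BASIS OF CRITICAL PERCOLATION, the operators `q²·1 + q·e_k` with
  `q² + q + 1 = 0` satisfy the braid relations** (`a = q²`, `b = q`): the Jones / Temperley–Lieb representation of the braid group at the percolation point,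
  as a kernel theorem on a tree object. (The marked-loop lineage's rotation of Khristoforov–Smirnov's `k` marks is the element `g_{*,0} ∘ ρ` of this kind of
  representation on the link basis: `Literature/Probability/Percolation/MarkedLoopTemperleyLieb.lean`, `MarkedLoopBraidRotation.lean`, with
  `(a, b) = (−τ, −τ²)`, `τ = e^{2πi/3}`, `a² + ab + b² = τ² + τ³ + τ⁴ = 0`.)

## References
* L. H. Kauffman, *Knots and Physics*, World Scientific (1991), Part I §7 (`σᵢ = A + A⁻¹Uᵢ`, the Temperley–Lieb relations, Prop. 7.4 / 7.5).
* P. A. Pearce, V. Rittenberg, J. de Gier, B. Nienhuis, J. Phys. A 35 (2002) L661–L668, §2 (TL).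
* Y. Ikhlef, A. K. Ponsaing, J. Stat. Phys. 149 (2012) 10–36, §2.1, §3.1 (loop weight `−(q + q⁻¹) = 1`, the connectivity basis).

## Mathlib / tree
Tree: `TemperleyLiebLinkPatterns.lean` (`IsTemperleyLiebFamily`), `TemperleyLiebConnectivityBasis.lean` (`tlConn`, `isTemperleyLiebFamily_tlConn`). Mathlib:
`Algebra.algebraMap_eq_smul_one`, `smul_mul_assoc`, `mul_smul_comm`, `match_scalars`, `linear_combination`.
-/

namespace Literature.Probability.LatticeModels.TemperleyLieb

/-! ### The one-line criterion -/

section Abstract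

variable {K : Type*} [CommRing K] {A : Type*} [Ring A] [Algebra K A]

/-- ★★ **BRAID RELATION FROM THE TEMPERLEY–LIEB RELATIONS AT LOOP WEIGHT ONE**: if `e₁² = e₁`, `e₂² = e₂`, `e₁e₂e₁ = e₁`, `e₂e₁e₂ = e₂` and
`a² + ab + b² = 0`, then `(a + b e₁)(a + b e₂)(a + b e₁) = (a + b e₂)(a + b e₁)(a + b e₂)` (the difference is `b(a² + ab + b²)(e₁ − e₂)`).
[cite: Kauffman1991KnotsPhysics, Part I §7 Prop. 7.4 and Prop. 7.5 (σᵢ = A + A⁻¹Uᵢ, the Temperley–Lieb relations)] -/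
theorem braid_of_tl_one {e₁ e₂ : A} (h11 : e₁ * e₁ = e₁) (h22 : e₂ * e₂ = e₂) (h121 : e₁ * e₂ * e₁ = e₁) (h212 : e₂ * e₁ * e₂ = e₂)
    {a b : K} (hab : a ^ 2 + a * b + b ^ 2 = 0) :
    (algebraMap K A a + b • e₁) * (algebraMap K A a + b • e₂) * (algebraMap K A a + b • e₁) =
      (algebraMap K A a + b • e₂) * (algebraMap K A a + b • e₁) * (algebraMap K A a + b • e₂) := by
  have key : (b * (a ^ 2 + a * b + b ^ 2)) • (e₁ - e₂) = 0 := by rw [hab, mul_zero, zero_smul]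
  rw [← sub_eq_zero]
  rw [← key]
  simp only [Algebra.algebraMap_eq_smul_one, mul_add, add_mul, smul_mul_assoc, mul_smul_comm, mul_one, one_mul, ← mul_assoc,
    h11, h22, h121, h212, smul_sub]
  module

/-- far generators give commuting Kauffman generators. [cite: Kauffman1991KnotsPhysics, Part I §7 Prop. 7.5] -/
theorem comm_of_tl_comm {e₁ e₂ : A} (h : e₁ * e₂ = e₂ * e₁) (a b : K) :
    (algebraMap K A a + b • e₁) * (algebraMap K A a + b • e₂) = (algebraMap K A a + b • e₂) * (algebraMap K A a + b • e₁) := by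
  simp only [Algebra.algebraMap_eq_smul_one, mul_add, add_mul, smul_mul_assoc, mul_smul_comm, mul_one, one_mul, h]
  module

end Abstract

/-! ### Every Temperley–Lieb family with `δ = 1` gives a braid representation -/

section Family

variable {K : Type*} [CommRing K] {V : Type*} [AddCommGroup V] [Module K V] {n : ℕ}

/-- **the Kauffman generator** `gⱼ = a·1 + b·eⱼ` of a family of endomorphisms. [cite: Kauffman1991KnotsPhysics, Part I §7 (σᵢ = A + A⁻¹Uᵢ)] -/
def kauffmanGen (e : Fin n → Module.End K V) (a b : K) (j : Fin n) : Module.End K V :=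
  algebraMap K (Module.End K V) a + b • e j

/-- the Kauffman generator unfolded. [cite: Kauffman1991KnotsPhysics, Part I §7] -/
theorem kauffmanGen_apply (e : Fin n → Module.End K V) (a b : K) (j : Fin n) (v : V) :
    kauffmanGen e a b j v = a • v + b • e j v := by
  simp [kauffmanGen, Module.algebraMap_end_apply]

/-- ★★ **THE BRAID RELATION `gⱼ g_{j+1} gⱼ = g_{j+1} gⱼ g_{j+1}`** for the Kauffman generators of a Temperley–Lieb family with loop weight ONE, whenever
`a² + ab + b² = 0`. [cite: Kauffman1991KnotsPhysics, Part I §7 Prop. 7.5; PearceRittenbergDeGierNienhuis2002, §2 (TL)] -/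
theorem IsTemperleyLiebFamily.braid {e : Fin n → Module.End K V} (h : IsTemperleyLiebFamily (1 : K) e) {a b : K}
    (hab : a ^ 2 + a * b + b ^ 2 = 0) (j k : Fin n) (hjk : k.val = j.val + 1) :
    kauffmanGen e a b j * kauffmanGen e a b k * kauffmanGen e a b j = kauffmanGen e a b k * kauffmanGen e a b j * kauffmanGen e a b k := by
  have h11 : e j * e j = e j := by rw [h.sq j, one_smul]
  have h22 : e k * e k = e k := by rw [h.sq k, one_smul]
  exact braid_of_tl_one h11 h22 (h.cubic_succ j k hjk) (h.cubic_pred j k hjk) hab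

/-- ★ **far Kauffman generators commute** (`|i − j| > 1`). [cite: Kauffman1991KnotsPhysics, Part I §7 Prop. 7.5; PearceRittenbergDeGierNienhuis2002, §2 (TL)] -/
theorem IsTemperleyLiebFamily.braid_comm {e : Fin n → Module.End K V} (h : IsTemperleyLiebFamily (1 : K) e) (a b : K) (i j : Fin n)
    (hij : j.val + 1 < i.val) :
    kauffmanGen e a b i * kauffmanGen e a b j = kauffmanGen e a b j * kauffmanGen e a b i :=
  comm_of_tl_comm (h.comm i j hij) a b

end Family

/-! ### The braid group on the percolation cluster basis -/

section Connectivity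

variable (m : ℕ) {K : Type*} [CommRing K]

/-- `q² + q + 1 = 0` gives the criterion with `a = q²`, `b = q`: `q⁴ + q³ + q² = q²(q² + q + 1) = 0`. [cite: IkhlefPonsaing2012, §3.1 (q = e^{2iπ/3})] -/
theorem sq_criterion_of_cube {q : K} (hq : q ^ 2 + q + 1 = 0) : (q ^ 2) ^ 2 + q ^ 2 * q + q ^ 2 = 0 := by
  linear_combination q ^ 2 * hq

/-- ★★★ **THE BRAID RELATIONS ON IKHLEF–PONSAING'S CONNECTIVITY BASIS OF CRITICAL PERCOLATION**: for `q² + q + 1 = 0` the operators `gₖ = q²·1 + q·eₖ`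
(`eₖ = tlConn m K k`, loop weight one) satisfy `gₖ g_{k+1} gₖ = g_{k+1} gₖ g_{k+1}` — the Temperley–Lieb (Jones) representation of the braid group at the
percolation point, on a tree object. [cite: Kauffman1991KnotsPhysics, Part I §7 Prop. 7.5; IkhlefPonsaing2012, §3.1] -/
theorem tlConn_braid {q : K} (hq : q ^ 2 + q + 1 = 0) (j k : Fin (2 * m)) (hjk : k.val = j.val + 1) :
    kauffmanGen (tlConn m K) (q ^ 2) q j * kauffmanGen (tlConn m K) (q ^ 2) q k * kauffmanGen (tlConn m K) (q ^ 2) q j =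
      kauffmanGen (tlConn m K) (q ^ 2) q k * kauffmanGen (tlConn m K) (q ^ 2) q j * kauffmanGen (tlConn m K) (q ^ 2) q k :=
  (isTemperleyLiebFamily_tlConn m K).braid (sq_criterion_of_cube hq) j k hjk

/-- ★ far generators commute on the connectivity basis. [cite: Kauffman1991KnotsPhysics, Part I §7 Prop. 7.5; IkhlefPonsaing2012, §3.1] -/
theorem tlConn_braid_comm (a b : K) (i j : Fin (2 * m)) (hij : j.val + 1 < i.val) :
    kauffmanGen (tlConn m K) a b i * kauffmanGen (tlConn m K) a b j = kauffmanGen (tlConn m K) a b j * kauffmanGen (tlConn m K) a b i :=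
  (isTemperleyLiebFamily_tlConn m K).braid_comm a b i j hij

end Connectivity

/-! ### General loop weight: Kauffman's criterion `a² + δab + b² = 0` and unitarity (ed. 2) -/

section GeneralLoopWeight

variable {K : Type*} [CommRing K] {A : Type*} [Ring A] [Algebra K A]

/-- ★★ **BRAID RELATION FROM THE TEMPERLEY–LIEB RELATIONS AT A GENERAL LOOP WEIGHT `δ`**: if `e₁² = δe₁`, `e₂² = δe₂`, `e₁e₂e₁ = e₁`, `e₂e₁e₂ = e₂`
and **`a² + δab + b² = 0`**, then `(a + b e₁)(a + b e₂)(a + b e₁) = (a + b e₂)(a + b e₁)(a + b e₂)` (the difference is `b(a² + δab + b²)(e₁ − e₂)`).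
Kauffman's normalisation is `a = A`, `b = A⁻¹`, where the criterion reads `A² + δ + A⁻² = 0`, i.e. the loop value `δ = −A² − A⁻²`; `braid_of_tl_one` is the
case `δ = 1`. [cite: Kauffman1991KnotsPhysics, Part I §7: relations [𝒜] (Fig. 13: UᵢU_{i±1}Uᵢ = Uᵢ, Uᵢ² = δUᵢ); ρ(σᵢ) = A + A⁻¹Uᵢ; Prop. 7.5, proof step «Second»] -/
theorem braid_of_tl {δ : K} {e₁ e₂ : A} (h11 : e₁ * e₁ = δ • e₁) (h22 : e₂ * e₂ = δ • e₂) (h121 : e₁ * e₂ * e₁ = e₁)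
    (h212 : e₂ * e₁ * e₂ = e₂) {a b : K} (hab : a ^ 2 + δ * a * b + b ^ 2 = 0) :
    (algebraMap K A a + b • e₁) * (algebraMap K A a + b • e₂) * (algebraMap K A a + b • e₁) =
      (algebraMap K A a + b • e₂) * (algebraMap K A a + b • e₁) * (algebraMap K A a + b • e₂) := by
  have key : (b * (a ^ 2 + δ * a * b + b ^ 2)) • (e₁ - e₂) = 0 := by rw [hab, mul_zero, zero_smul]
  rw [← sub_eq_zero]
  rw [← key]
  simp only [Algebra.algebraMap_eq_smul_one, mul_add, add_mul, smul_mul_assoc, mul_smul_comm, mul_one, one_mul, ← mul_assoc,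
    h11, h22, h121, h212, smul_sub, smul_smul]
  module

/-- ★★ **KAUFFMAN UNITARITY AT A GENERAL LOOP WEIGHT**: if `e² = δe`, `a·a' = 1` and `a·b' + b·a' + δ·b·b' = 0`, then `(a + b e)(a' + b' e) = 1`
(the product is `aa' + (ab' + ba' + δbb')e`). Kauffman's normalisation: `(a, b) = (A, A⁻¹)`, `(a', b') = (A⁻¹, A)`, the condition being `A² + A⁻² + δ = 0`
again — the inverse braid generator is `σᵢ⁻¹ = A⁻¹ + A Uᵢ`. [cite: Kauffman1991KnotsPhysics, Part I §7: ρ(σᵢ) = A + A⁻¹Uᵢ, ρ(σᵢ⁻¹) = A⁻¹ + AUᵢ; Prop. 7.5, proof step «First»: (A + A⁻¹Uᵢ)(A⁻¹ + AUᵢ) = 1 + (A⁻² + A²)Uᵢ + δUᵢ = 1] -/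
theorem kauffman_mul_eq_one {δ : K} {e : A} (he : e * e = δ • e) {a b a' b' : K} (h1 : a * a' = 1)
    (h2 : a * b' + b * a' + δ * b * b' = 0) :
    (algebraMap K A a + b • e) * (algebraMap K A a' + b' • e) = 1 := by
  have key : (a * b' + b * a' + δ * b * b') • e = 0 := by rw [h2, zero_smul]
  have h1' : (a * a') • (1 : A) = 1 := by rw [h1, one_smul]
  rw [← h1', ← add_zero ((a * a') • (1 : A)), ← key]
  simp only [Algebra.algebraMap_eq_smul_one, mul_add, add_mul, smul_mul_assoc, mul_smul_comm, mul_one, one_mul, he, smul_smul]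
  module

/-- at loop weight ONE the unitarity conditions hold for `(a, b) = (u, v)` and `(a', b') = (v, u)` whenever `uv = 1` and `u² + uv + v² = 0` (e.g. `u = −τ`,
`v = −τ²`): then `(u + v e)(v + u e) = 1`. [cite: Kauffman1991KnotsPhysics, Part I §7 Prop. 7.5] -/
theorem kauffman_mul_eq_one_of_one {e : A} (he : e * e = e) {u v : K} (huv : u * v = 1) (hq : u ^ 2 + u * v + v ^ 2 = 0) :
    (algebraMap K A u + v • e) * (algebraMap K A v + u • e) = 1 := by
  refine kauffman_mul_eq_one (δ := (1 : K)) (by rw [he, one_smul]) huv ?_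
  linear_combination hq

variable {V : Type*} [AddCommGroup V] [Module K V] {n : ℕ}

/-- ★★ **THE BRAID RELATION FOR THE KAUFFMAN GENERATORS OF A TEMPERLEY–LIEB FAMILY WITH ANY LOOP WEIGHT `δ`**, whenever `a² + δab + b² = 0`
(`IsTemperleyLiebFamily.braid` is the case `δ = 1`). [cite: Kauffman1991KnotsPhysics, Part I §7 Prop. 7.5; PearceRittenbergDeGierNienhuis2002, §2 (TL)] -/
theorem IsTemperleyLiebFamily.braid_of_loopWeight {δ : K} {e : Fin n → Module.End K V} (h : IsTemperleyLiebFamily δ e) {a b : K}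
    (hab : a ^ 2 + δ * a * b + b ^ 2 = 0) (j k : Fin n) (hjk : k.val = j.val + 1) :
    kauffmanGen e a b j * kauffmanGen e a b k * kauffmanGen e a b j = kauffmanGen e a b k * kauffmanGen e a b j * kauffmanGen e a b k :=
  braid_of_tl (h.sq j) (h.sq k) (h.cubic_succ j k hjk) (h.cubic_pred j k hjk) hab

/-- far Kauffman generators of a Temperley–Lieb family with ANY loop weight commute (`IsTemperleyLiebFamily.braid_comm` is stated at `δ = 1`).
[cite: Kauffman1991KnotsPhysics, Part I §7 Prop. 7.5; PearceRittenbergDeGierNienhuis2002, §2 (TL)] -/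
theorem IsTemperleyLiebFamily.braid_comm_of_loopWeight {δ : K} {e : Fin n → Module.End K V} (h : IsTemperleyLiebFamily δ e) (a b : K)
    (i j : Fin n) (hij : j.val + 1 < i.val) :
    kauffmanGen e a b i * kauffmanGen e a b j = kauffmanGen e a b j * kauffmanGen e a b i :=
  comm_of_tl_comm (h.comm i j hij) a b

/-- ★★ **THE INVERSE KAUFFMAN GENERATOR** of a Temperley–Lieb family with loop weight `δ`: `(a + b eⱼ)(a' + b' eⱼ) = 1` when `aa' = 1` and
`ab' + ba' + δbb' = 0`. [cite: Kauffman1991KnotsPhysics, Part I §7 Prop. 7.4 / 7.5 (σᵢ⁻¹ = A⁻¹ + AUᵢ)] -/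
theorem IsTemperleyLiebFamily.kauffmanGen_mul_kauffmanGen {δ : K} {e : Fin n → Module.End K V} (h : IsTemperleyLiebFamily δ e) {a b a' b' : K}
    (h1 : a * a' = 1) (h2 : a * b' + b * a' + δ * b * b' = 0) (j : Fin n) :
    kauffmanGen e a b j * kauffmanGen e a' b' j = 1 :=
  kauffman_mul_eq_one (h.sq j) h1 h2

end GeneralLoopWeight

end Literature.Probability.LatticeModels.TemperleyLieb
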